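import Mathlib
import Summits.Ventures.PercRepro2.A3PendantOFibres

/-!
# (MEANS-a₃) holds when `a₃` is a leaf at `o` — the first kernel class theorem of `A3Between`
(blind cell PercRepro2, night-1 g30; proofs/NIGHT1-G30.md §6, the paper theorem of NIGHT1-G29.md §5.3 (c))

With the fibre lemmas of A3PendantOFibres.lean, the between-term of p5's reduction
(`A3Fibre.btw`, `A3FibreMain.HCov_of_a3Between : A3Between → HCov`) at a leaf `a₃` attached to `o` by
the edge `f` of weight `q` is explicit (`btw_leaf_expanded`) and collapses to

  **`btw = q (1 − q) · m_o · T₀ / (D · P(Q)²)`**   (`btw_pendant_o`, for `P(Q) ≠ 0`, `D ≠ 0`),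

with `m_o = P(Q, o ∈ U)`, `D = P(PD)` and `T₀ = LeafStep.T0` the `a₃`-free functional
(`= 2P(Q)·[BHK 1.4 slacks of (o, b)]`, `LeafStep.T0_nonneg`); when `P(Q) = 0` or `D = 0` the
between-term vanishes (`btw_eq_zero_of_prob_Q_eq_zero`, `btw_eq_zero_of_D_eq_zero_leaf`).  Hence
**`A3Between_pendant_o`**: (MEANS-a₃) holds at every weight of the leaf edge — the kernel form of
NIGHT1-G29.md §5.3 (c) («`btw(t) = t·s·⟨U_o⟩·[Cov(σ_b,σ_o) − Cov(U_b,U_o)]`»).  Standard axioms.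
-/

namespace Summit.Ventures.PercRepro2

open UnionCluster CovForm PendantRoot PendantO

namespace CovForm

namespace A3Fibre

section Assembly

variable {V : Type*} {E : Type*} [Fintype V] [DecidableEq V] [Fintype E] [DecidableEq E]
  {R : Type*} [Field R] [LinearOrder R] [IsStrictOrderedRing R]
  {ends : E → Sym2 V} {f : E} {a₃ o : V}

/-- **The between-term at a leaf `a₃` at `o`, before the algebra**: every fibre quantity of `btw`
expressed through the `o`-marked masses. -/
lemma btw_leaf_expanded {p : E → R} (hp : IsProbVec p) (hf : ends f = s(a₃, o))
    (hleaf : ∀ e, a₃ ∈ ends e → e = f) (h3o : a₃ ≠ o) {a₁ a₂ b : V} (h31 : a₃ ≠ a₁) (h32 : a₃ ≠ a₂)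
    (hb : b ≠ a₃) :
    btw p ends o a₁ a₂ a₃ b =
      ((prob p (avoidAll ends a₂ {a₁} ∩ connEvent ends a₁ b) -
            prob p (avoidAll ends a₂ {a₁} ∩ connEvent ends a₂ b)) * (1 - p f)) *
          ((prob p (avoidAll ends a₂ {a₁} ∩ connEvent ends a₁ o) -
            prob p (avoidAll ends a₂ {a₁} ∩ connEvent ends a₂ o)) * (1 - p f)) /
          (prob p (avoidAll ends a₂ {a₁}) * (1 - p f)) +
        Do p ends o a₁ a₂ a₃ / prob p (PDEvent ends a₁ a₂ a₃) * (p f * EQbo p ends o a₁ a₂ b) -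
        EQo p ends b a₁ a₂ *
          (EQo p ends o a₁ a₂ +
            Do p ends o a₁ a₂ a₃ / prob p (PDEvent ends a₁ a₂ a₃) * (p f * EQo p ends o a₁ a₂) -
            p f * EQo p ends o a₁ a₂) / prob p (avoidAll ends a₂ {a₁}) -
        ((prob p (avoidAll ends a₂ {a₁} ∩ connEvent ends a₁ b) +
            prob p (avoidAll ends a₂ {a₁} ∩ connEvent ends a₂ b)) * (1 - p f)) *
          ((prob p (avoidAll ends a₂ {a₁} ∩ connEvent ends a₁ o) +
            prob p (avoidAll ends a₂ {a₁} ∩ connEvent ends a₂ o)) * (1 - p f)) /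
          (prob p (avoidAll ends a₂ {a₁}) * (1 - p f)) +
        PDb p ends a₁ a₂ a₃ b * Do p ends o a₁ a₂ a₃ / prob p (PDEvent ends a₁ a₂ a₃) := by
  unfold btw
  rw [sum_Ssig_SF_div_leaf hp hf hleaf h3o h31 h32 b, sum_Su_Su_div_leaf hp hf hleaf h3o h31 h32 b,
    ← EQb3_eq, ← EQo_eq p ends b a₁ a₂ a₃, sum_SF, ← EQo_eq, ← EQ3_eq, ← EQ3o_eq,
    fibresA, Finset.sum_filter, Finset.sum_filter, ← PDb_eq, ← Do_eq,
    SF_singleton_leaf p h31 h32, mW_singleton_leaf p hf hleaf h3o h31 h32,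
    Ssig_singleton_leaf p hf hleaf h3o h31 h32 hb, Ssig_singleton_leaf p hf hleaf h3o h31 h32 (Ne.symm h3o),
    Su_singleton_leaf p hf hleaf h3o h31 h32 hb, Su_singleton_leaf p hf hleaf h3o h31 h32 (Ne.symm h3o),
    EQb3_leaf p hf hleaf h3o h31 h32 hb, EQ3_leaf p hf hleaf h3o h31 h32, EQ3o_leaf p hf hleaf h3o h31 h32]
  unfold gamma
  ring

end Assembly


section Closed

variable {V : Type*} {E : Type*} [Fintype V] [DecidableEq V] [Fintype E] [DecidableEq E]
  {R : Type*} [Field R] [LinearOrder R] [IsStrictOrderedRing R]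
  {ends : E → Sym2 V} {f : E} {a₃ o : V}

/-- **The closed form of the between-term at a leaf `a₃` at `o`**:
`btw = q (1 − q) · m_o · T₀ / (D · P(Q)²)` when `P(Q) ≠ 0` and `D ≠ 0`. -/
theorem btw_pendant_o {p : E → R} (hp : IsProbVec p) (hf : ends f = s(a₃, o))
    (hleaf : ∀ e, a₃ ∈ ends e → e = f) (h3o : a₃ ≠ o) {a₁ a₂ b : V} (h31 : a₃ ≠ a₁) (h32 : a₃ ≠ a₂)
    (hb : b ≠ a₃) (hQ : prob p (avoidAll ends a₂ {a₁}) ≠ 0)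
    (hD : prob p (PDEvent ends a₁ a₂ a₃) ≠ 0) :
    btw p ends o a₁ a₂ a₃ b =
      p f * (1 - p f) * LeafStep.mU p ends a₁ a₂ o * LeafStep.T0 p ends o a₁ a₂ b /
        (prob p (PDEvent ends a₁ a₂ a₃) * prob p (avoidAll ends a₂ {a₁}) ^ 2) := by
  rw [btw_leaf_expanded hp hf hleaf h3o h31 h32 hb, Do_leaf p hf hleaf h3o h31 h32,
    PDb_leaf p hf hleaf h3o h31 h32 hb]
  rw [prob_PD_o p hf hleaf h3o h31 h32] at hD ⊢
  unfold LeafStep.T0 LeafStep.mU LeafStep.mUU EQbo EQo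
  rw [gap_eq_Q]
  by_cases h1 : (1 : R) - p f = 0
  · have hpf : p f = 1 := by linarith
    rw [h1, hpf]
    simp
  · field_simp
    ring

/-- The between-term vanishes when `P(Q) = 0` (every fibre is null). -/
lemma btw_eq_zero_of_prob_Q_eq_zero {p : E → R} (hp : IsProbVec p) (ends : E → Sym2 V)
    (o a₁ a₂ a₃ b : V) (hQ : prob p (avoidAll ends a₂ {a₁}) = 0) :
    btw p ends o a₁ a₂ a₃ b = 0 := by
  have hm : ∀ W : Finset V, mW p ends a₁ a₂ a₃ W = 0 := by
    intro W
    have h1 : prob p (fibre ends a₁ a₂ a₃ W) ≤ prob p (avoidAll ends a₂ {a₁}) :=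
      prob_mono hp Set.inter_subset_left
    have h2 := prob_nonneg hp (fibre ends a₁ a₂ a₃ W)
    rw [hQ] at h1
    unfold mW
    linarith
  unfold btw
  have e1 : ∀ W : Finset V, Ssig p ends a₁ a₂ a₃ b W * SF p ends o a₁ a₂ a₃ W / mW p ends a₁ a₂ a₃ W = 0 := by
    intro W
    rw [Ssig_eq_zero_of_mW_eq_zero hp ends a₁ a₂ a₃ b W (hm W)]
    simp
  have e2 : ∀ W : Finset V, Ssig p ends a₁ a₂ a₃ b W = 0 :=
    fun W => Ssig_eq_zero_of_mW_eq_zero hp ends a₁ a₂ a₃ b W (hm W)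
  have e3 : ∀ W ∈ fibresA a₁ a₂,
      Su p ends a₁ a₂ a₃ b W * Su p ends a₁ a₂ a₃ o W / mW p ends a₁ a₂ a₃ W = 0 := by
    intro W _
    rw [Su_eq_zero_of_mW_eq_zero hp ends a₁ a₂ a₃ b W (hm W)]
    simp
  have e4 : ∀ W ∈ fibresA a₁ a₂, Su p ends a₁ a₂ a₃ b W = 0 :=
    fun W _ => Su_eq_zero_of_mW_eq_zero hp ends a₁ a₂ a₃ b W (hm W)
  rw [Finset.sum_congr rfl (fun W _ => e1 W), Finset.sum_congr rfl (fun W _ => e2 W),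
    Finset.sum_congr rfl e3, Finset.sum_congr rfl e4]
  simp

omit [Fintype V] [DecidableEq V] in
/-- `P(Q, o ∈ C₁) + P(Q, o ∈ C₂) ≤ P(Q)`. -/
lemma mU_le_prob_Q' {p : E → R} (hp : IsProbVec p) (ends : E → Sym2 V) (a₁ a₂ o : V) :
    prob p (avoidAll ends a₂ {a₁} ∩ connEvent ends a₁ o) +
      prob p (avoidAll ends a₂ {a₁} ∩ connEvent ends a₂ o) ≤ prob p (avoidAll ends a₂ {a₁}) := by
  have h := prob_union_add_prob_inter p (avoidAll ends a₂ {a₁} ∩ connEvent ends a₁ o)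
    (avoidAll ends a₂ {a₁} ∩ connEvent ends a₂ o)
  have e : avoidAll ends a₂ {a₁} ∩ connEvent ends a₁ o ∩ (avoidAll ends a₂ {a₁} ∩ connEvent ends a₂ o) =
      avoidAll ends a₂ {a₁} ∩ (connEvent ends a₁ o ∩ connEvent ends a₂ o) := by
    ext ω; simp only [Set.mem_inter_iff]; tauto
  rw [e, Q_inter_both_eq_empty₂ ends a₁ a₂ o, prob_empty, add_zero] at h
  have hsub : avoidAll ends a₂ {a₁} ∩ connEvent ends a₁ o ∪ avoidAll ends a₂ {a₁} ∩ connEvent ends a₂ o ⊆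
      avoidAll ends a₂ {a₁} := by
    intro ω hω
    rcases hω with h | h <;> exact h.1
  have := prob_mono hp hsub
  linarith

/-- The between-term vanishes when `D = 0` and `P(Q) ≠ 0` at a leaf at `o` (then `q = 1`). -/
lemma btw_eq_zero_of_D_eq_zero_leaf {p : E → R} (hp : IsProbVec p) (hf : ends f = s(a₃, o))
    (hleaf : ∀ e, a₃ ∈ ends e → e = f) (h3o : a₃ ≠ o) {a₁ a₂ b : V} (h31 : a₃ ≠ a₁) (h32 : a₃ ≠ a₂)
    (hb : b ≠ a₃) (hQ : prob p (avoidAll ends a₂ {a₁}) ≠ 0)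
    (hD : prob p (PDEvent ends a₁ a₂ a₃) = 0) :
    btw p ends o a₁ a₂ a₃ b = 0 := by
  have hpf : p f = 1 := by
    have hD' := hD
    rw [prob_PD_o p hf hleaf h3o h31 h32] at hD'
    have hm := mU_le_prob_Q' hp ends a₁ a₂ o
    have hq1 := hp.le_one f
    have hq0 := hp.nonneg f
    have hQpos : 0 < prob p (avoidAll ends a₂ {a₁}) :=
      lt_of_le_of_ne (prob_nonneg hp _) (Ne.symm hQ)
    have hmo := prob_nonneg hp (avoidAll ends a₂ {a₁} ∩ connEvent ends a₁ o)
    have hmo' := prob_nonneg hp (avoidAll ends a₂ {a₁} ∩ connEvent ends a₂ o)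
    nlinarith
  rw [btw_leaf_expanded hp hf hleaf h3o h31 h32 hb, hD, Do_leaf p hf hleaf h3o h31 h32, hpf]
  simp

/-- **(MEANS-a₃) at a leaf `a₃` attached to `o`, at every weight of the leaf edge.** -/
theorem A3Between_pendant_o {p : E → R} (hp : IsProbVec p) (hf : ends f = s(a₃, o))
    (hleaf : ∀ e, a₃ ∈ ends e → e = f) (h3o : a₃ ≠ o) {a₁ a₂ b : V} (h31 : a₃ ≠ a₁) (h32 : a₃ ≠ a₂)
    (hb : b ≠ a₃) : A3Between p ends o a₁ a₂ a₃ b := by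
  unfold A3Between
  by_cases hQ : prob p (avoidAll ends a₂ {a₁}) = 0
  · rw [btw_eq_zero_of_prob_Q_eq_zero hp ends o a₁ a₂ a₃ b hQ]
  by_cases hD : prob p (PDEvent ends a₁ a₂ a₃) = 0
  · rw [btw_eq_zero_of_D_eq_zero_leaf hp hf hleaf h3o h31 h32 hb hQ hD]
  rw [btw_pendant_o hp hf hleaf h3o h31 h32 hb hQ hD]
  have hq0 := hp.nonneg f
  have hq1 : 0 ≤ 1 - p f := sub_nonneg.2 (hp.le_one f)
  have hmo : 0 ≤ LeafStep.mU p ends a₁ a₂ o := by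
    unfold LeafStep.mU
    have := prob_nonneg hp (avoidAll ends a₂ {a₁} ∩ connEvent ends a₁ o)
    have := prob_nonneg hp (avoidAll ends a₂ {a₁} ∩ connEvent ends a₂ o)
    linarith
  have hT := LeafStep.T0_nonneg p ends hp o a₁ a₂ b
  have hDn := prob_nonneg hp (PDEvent ends a₁ a₂ a₃)
  have hQn := prob_nonneg hp (avoidAll ends a₂ {a₁})
  exact div_nonneg (mul_nonneg (mul_nonneg (mul_nonneg hq0 hq1) hmo) hT)
    (mul_nonneg hDn (sq_nonneg _))

end Closed

end A3Fibre

end CovForm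

end Summit.Ventures.PercRepro2
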